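import Summits.NavierStokesRegularity.NavierStokesRegularity.Theorems.AdaptedFrequencyAdaptedKernelExistsLowerOfUpperBridge

/-!
# Crux `AdaptedKernelExists` (stmt-NavierStokesRegularity-2956), line `nash-entropy-last-block`:
  the COMPARISON FROM ABOVE for STUB `stub_upperOfMoments`

Helper file (lands `--supports stmt-NavierStokesRegularity-2956`) for the registered stub
`stub_upperOfMoments` of the line's skeleton (Gaussian upper bound on the last block for an
adapted backward kernel `G` of `∂ₜ + b·∇ − νΔ`, `IsAdaptedBackwardKernel ν b (Ico t₀ T) T x₀ G`,
from exponential moments). This file carries the comparison step, for a general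
finite-dimensional inner product space `E`:

* `upperOfMoments_exists_sub_le_heatExtension`: the lower half of the uniform approximate
  identity `h − δ ≤ e^{σΔ} h` on a compact set for small `σ > 0` (twin of the tree's
  `exists_heatExtension_le_add`);
* `upperOfMoments_heatKernel_le_driftKernel_one`,
  `upperOfMoments_heatExtension_le_driftKernelBarrier`: the supersolution kernel
  `k₊ = driftKernel 1 A` dominates the heat kernel, so `e^{σΔ} h ≤ Ψ₊(σ) = k₊(σ) ⋆ h` for a
  weight `h ≥ 0`;
* `upperOfMoments_comparison`: on an interior block `[t, t + τ] ⊆ (t₀, T)` with `‖b‖ ≤ B`, if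
  `G(s, y) → 0` as `‖y − x₀‖ → ∞` uniformly in `s ∈ [t, t + τ]`, then for every `δ > 0` there is
  an age offset `σ₀ ∈ (0, ντ]` with
  `G(t, x) ≤ ∫ G(t + τ, z) k₊(ντ + σ₀, x − z) dz + δ`:
  the reversed kernel `v(σ) = G(t + τ − σ/ν)` is in the local drift–heat class
  (`lowerOfUpper_bridge`), and the tree's comparison principle
  `IsDriftHeatSolutionOn.paraboloid_comparison` on a large cylinder `[0, ντ] × B̄(x₀, ρ)` with
  the classical supersolution barrier `Ψ₊(σ + σ₀) + δ` (`driftKernelBarrier_ineq`, `ε = 1`),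
  above `v` at the bottom by the approximate identity and on the side by the decay of `G`,
  bounds `v(ντ) = G(t)` from above.

Its `ℝ³` form is the registered sub-goal `stub_upperOfMoments_comparison` of the crux item.
-/

noncomputable section

open MeasureTheory Set Filter Topology Metric Function Real
open scoped Laplacian
open Literature.Analysis.FluidPDE Literature.Analysis.UnboundedOperators

namespace Summit.NavierStokesRegularity.NavierStokesRegularity.Theorems.AdaptedKernelExists.NashEntropyLastBlock

section General

variable {E : Type*} [NormedAddCommGroup E] [InnerProductSpace ℝ E] [FiniteDimensional ℝ E]
  [MeasurableSpace E] [BorelSpace E]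

/-! ### The approximate identity from below and the supersolution barrier -/

/-- **Uniform approximate identity from below**: for a continuous compactly supported `h`, a
compact `K` and `δ > 0`, `h(x) − δ ≤ e^{σΔ} h (x)` for all `x ∈ K` and all sufficiently small
`σ > 0` (joint continuity of the caloric extension at the initial time plus compactness; the
twin of `exists_heatExtension_le_add`). -/
theorem upperOfMoments_exists_sub_le_heatExtension {h : E → ℝ} (hh : Continuous h)
    (hhs : HasCompactSupport h) {K : Set E} (hK : IsCompact K) {δ : ℝ} (hδ : 0 < δ) :
    ∃ σ₁ : ℝ, 0 < σ₁ ∧ ∀ σ ∈ Ioo 0 σ₁, ∀ x ∈ K,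
      h x - δ ≤ heatExtension h σ x := by
  obtain ⟨C, hC⟩ := hh.bounded_above_of_compact_support hhs
  have hP : ∀ x₀ ∈ K, ∀ᶠ q : ℝ × E in 𝓝 ((0 : ℝ), x₀),
      0 < q.1 → h q.2 - δ ≤ heatExtension h q.1 q.2 := by
    intro x₀ _
    have hT := tendsto_heatExtension_nhdsWithin_prod (F := ℝ) hh hC x₀
    have h1 : ∀ᶠ q : ℝ × E in 𝓝[Ioi 0 ×ˢ univ] ((0 : ℝ), x₀),
        h x₀ - δ / 2 < heatExtension h q.1 q.2 :=
      hT (Ioi_mem_nhds (by linarith))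
    have h2 : ∀ᶠ q : ℝ × E in 𝓝 ((0 : ℝ), x₀), h q.2 < h x₀ + δ / 2 := by
      have hc : ContinuousAt (fun q : ℝ × E => h q.2) ((0 : ℝ), x₀) :=
        (hh.comp continuous_snd).continuousAt
      exact hc.tendsto.eventually (gt_mem_nhds (by linarith))
    rw [eventually_nhdsWithin_iff] at h1
    filter_upwards [h1, h2] with q hq1 hq2 hq
    have := hq1 ⟨hq, mem_univ _⟩
    linarith
  have hev := hK.eventually_forall_of_forall_eventually
    (P := fun σ x => 0 < σ → h x - δ ≤ heatExtension h σ x) hP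
  obtain ⟨ε, hε, hball⟩ := Metric.eventually_nhds_iff.1 hev
  refine ⟨ε, hε, fun σ hσ x hx => hball ?_ x hx hσ.1⟩
  rw [Real.dist_eq, sub_zero, abs_of_pos hσ.1]
  exact hσ.2

omit [FiniteDimensional ℝ E] [MeasurableSpace E] [BorelSpace E] in
/-- The supersolution kernel dominates the heat kernel: `heatKernel σ y ≤ k₊(σ, y)` (`A ≥ 0`,
`σ > 0`; the tilt factor `e^{+(…)}` is at least one). -/
theorem upperOfMoments_heatKernel_le_driftKernel_one {A σ : ℝ} (hA : 0 ≤ A) (hσ : 0 < σ)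
    (y : E) : heatKernel σ y ≤ driftKernel 1 A σ y := by
  rw [driftKernel_eq_heatKernel_mul, one_mul]
  refine le_mul_of_one_le_right (heatKernel_pos hσ y).le ?_
  rw [one_le_exp_iff]
  exact driftKernel_tilt_nonneg hA hσ.le y

/-- **`e^{σΔ} h ≤ Ψ₊(σ) = k₊(σ) ⋆ h`** for a continuous compactly supported weight `h ≥ 0`
(`A ≥ 0`, `σ > 0`). -/
theorem upperOfMoments_heatExtension_le_driftKernelBarrier {A : ℝ} (hA : 0 ≤ A) {h : E → ℝ}
    (hh : Continuous h) (hhs : HasCompactSupport h) (h0 : ∀ z, 0 ≤ h z) {σ : ℝ} (hσ : 0 < σ)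
    (x : E) :
    heatExtension h σ x ≤ driftKernelBarrier 1 A h σ x := by
  rw [heatExtension_apply]
  have hsub : (∫ y, heatKernel σ y • h (x - y)) =
      ∫ z, heatKernel σ (x - z) * h z := by
    have e := integral_sub_left_eq_self
      (fun y => heatKernel σ y * h (x - y)) volume x
    simp only [sub_sub_cancel] at e
    simp only [smul_eq_mul]
    exact e.symm
  rw [hsub]
  have hint : Integrable fun z => heatKernel σ (x - z) * h z := by
    refine Continuous.integrable_of_hasCompactSupport ?_ ?_
    · exact ((continuous_heatKernel σ).comp (by fun_prop)).mul hh
    · exact HasCompactSupport.intro hhs fun z hz => by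
        simp [image_eq_zero_of_notMem_tsupport hz]
  refine integral_le_driftKernelBarrier hh hhs hσ x hint fun z => ?_
  rw [mul_comm]
  exact mul_le_mul_of_nonneg_left (upperOfMoments_heatKernel_le_driftKernel_one hA hσ _) (h0 z)

/-- The slice `z ↦ G(s, z) k₊(σ, x − z)` of an integrable `G(s, ·)` against the bounded
continuous kernel `k₊(σ, ·)` is integrable (`σ > 0`, `A ≥ 0`). -/
theorem upperOfMoments_integrable_mul_driftKernel {A σ : ℝ} (hA : 0 ≤ A) (hσ : 0 < σ)
    {g : E → ℝ} (hg : Integrable g) (x : E) :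
    Integrable fun z => g z * driftKernel 1 A σ (x - z) := by
  have hk : Continuous fun z => driftKernel (E := E) 1 A σ (x - z) :=
    (contDiff_driftKernel (N := 0) 1 A hσ).continuous.comp (by fun_prop)
  refine hg.mul_bdd (c := kSupTail (Module.finrank ℝ E) A 0 σ) hk.aestronglyMeasurable
    (Eventually.of_forall fun z => ?_)
  rw [Real.norm_of_nonneg (driftKernel_pos 1 A hσ _).le]
  exact driftKernel_le_kSupTail (by norm_num) hA hσ le_rfl (norm_nonneg _)

/-! ### The comparison from above -/

/-- **Comparison from above on an interior block.** Let `G` be an adapted backward kernel of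
`∂ₜ + b·∇ − νΔ` on `Ico t₀ T`, `[t, t + τ] ⊆ (t₀, T)` an interior block on which `‖b‖ ≤ B`
(`B ≥ 0`), and suppose `G(s, y) ≤ δ` for `‖y − x₀‖ ≥ ρ₀(δ)`, uniformly in `s ∈ [t, t + τ]`.
Then for every `x` and `δ > 0` there is `σ₀ ∈ (0, ντ]` with
`G(t, x) ≤ ∫ G(t + τ, z) k₊(ντ + σ₀, x − z) dz + δ`, `k₊ = driftKernel 1 (B/ν)`.
Proof: the reversed kernel `v(σ) = G(t + τ − σ/ν)` is in the local drift–heat class with drift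
bound `B/ν` (`lowerOfUpper_bridge`); compare `−v` on the cylinder `[0, ντ] × B̄(x₀, ρ)` with the
classical subsolution `−Ψ₊(σ + σ₀) − δ`, `Ψ₊ = k₊ ⋆ (ψ · G(t + τ))` (`ψ` a bump of
`B̄(x₀, ρ) ⊂ B̄(x₀, ρ + 1)`; `driftKernelBarrier_ineq` with `ε = 1`), which lies below `−v` at
the bottom (`e^{σ₀Δ} h ≥ h − δ` on the ball, `Ψ₊ ≥ e^{σ₀Δ} h`) and on the side (`v ≤ δ` there
for `ρ ≥ ρ₀(δ)`, `Ψ₊ ≥ 0`), by `IsDriftHeatSolutionOn.paraboloid_comparison`; at `σ = ντ` and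
the centre region this is `G(t, x) ≤ Ψ₊(ντ + σ₀, x) + δ ≤ ∫ G(t + τ) k₊(ντ + σ₀, x − ·) + δ`. -/
theorem upperOfMoments_comparison {ν t₀ T t τ B : ℝ} {b : ℝ → E → E} {x₀ : E} {G : ℝ → E → ℝ}
    (hν : 0 < ν) (ht : t₀ < t) (hτ : 0 < τ) (htT : t + τ < T)
    (hb : IsSmoothSpaceTimeOn (Ico t₀ T) b) (hB : ∀ s ∈ Icc t (t + τ), ∀ x, ‖b s x‖ ≤ B)
    (hB0 : 0 ≤ B) (hG : IsAdaptedBackwardKernel ν b (Ico t₀ T) T x₀ G)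
    (hdecay : ∀ δ : ℝ, 0 < δ → ∃ ρ₀ : ℝ, ∀ s ∈ Icc t (t + τ), ∀ y, ρ₀ ≤ ‖y - x₀‖ → G s y ≤ δ)
    (x : E) {δ : ℝ} (hδ : 0 < δ) :
    ∃ σ₀ : ℝ, 0 < σ₀ ∧ σ₀ ≤ ν * τ ∧
      G t x ≤ (∫ z, G (t + τ) z * driftKernel 1 (B / ν) (ν * τ + σ₀) (x - z)) + δ := by
  obtain ⟨a, hv⟩ := lowerOfUpper_bridge hν ht hτ htT hb hB hG
  have hg := hv.neg
  have hA : 0 ≤ B / ν := div_nonneg hB0 hν.le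
  have hστ : 0 < ν * τ := mul_pos hν hτ
  have ht'S : t + τ ∈ Ico t₀ T := ⟨by linarith, htT⟩
  -- the radius of the cylinder
  obtain ⟨ρ₀, hρ₀⟩ := hdecay δ hδ
  obtain ⟨ρ, hρ⟩ : ∃ ρ : ℝ, ρ = max ρ₀ ‖x - x₀‖ + 1 := ⟨_, rfl⟩
  have hρx : ‖x - x₀‖ ≤ ρ := by rw [hρ]; linarith [le_max_right ρ₀ ‖x - x₀‖]
  have hρρ₀ : ρ₀ ≤ ρ := by rw [hρ]; linarith [le_max_left ρ₀ ‖x - x₀‖]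
  have hρ0 : 0 < ρ := by rw [hρ]; linarith [le_max_right ρ₀ ‖x - x₀‖, norm_nonneg (x - x₀)]
  -- the weight `hw = ψ · G(t + τ)`
  let ψ : ContDiffBump x₀ := ⟨ρ, ρ + 1, hρ0, by linarith⟩
  have hG0 : ∀ z, 0 ≤ G (t + τ) z := fun z => (hG.pos _ ht'S z).le
  obtain ⟨hw, hhw⟩ : ∃ hw : E → ℝ, hw = fun z => ψ z * G (t + τ) z := ⟨_, rfl⟩
  have hwc : Continuous hw := by
    rw [hhw]; exact ψ.continuous.mul (hG.contDiff_slice ht'S).continuous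
  have hw0 : ∀ z, 0 ≤ hw z := fun z => by rw [hhw]; exact mul_nonneg ψ.nonneg (hG0 z)
  have hwG : ∀ z, hw z ≤ G (t + τ) z := fun z => by
    rw [hhw]
    calc ψ z * G (t + τ) z ≤ 1 * G (t + τ) z := mul_le_mul_of_nonneg_right ψ.le_one (hG0 z)
      _ = G (t + τ) z := one_mul _
  have hws : HasCompactSupport hw := by
    rw [hhw]; exact hasCompactSupport_mul_lambda ψ.hasCompactSupport
  have hwball : ∀ z ∈ closedBall x₀ ρ, hw z = G (t + τ) z := fun z hz => by
    rw [hhw]; simp only [ψ.one_of_mem_closedBall hz, one_mul]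
  -- the age offset from the approximate identity
  obtain ⟨σ₁, hσ₁, hAI⟩ :=
    upperOfMoments_exists_sub_le_heatExtension hwc hws (isCompact_closedBall x₀ ρ) hδ
  obtain ⟨σ₀, hσ₀_def⟩ : ∃ σ₀ : ℝ, σ₀ = min (σ₁ / 2) (ν * τ) := ⟨_, rfl⟩
  have hσ₀ : 0 < σ₀ := by rw [hσ₀_def]; exact lt_min (by linarith) hστ
  have hσ₀1 : σ₀ < σ₁ := by rw [hσ₀_def]; exact (min_le_left _ _).trans_lt (by linarith)
  have hσ₀τ : σ₀ ≤ ν * τ := by rw [hσ₀_def]; exact min_le_right _ _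
  refine ⟨σ₀, hσ₀, hσ₀τ, ?_⟩
  -- bookkeeping of the shifted age
  have hage : ∀ σ ∈ Icc 0 (ν * τ), 0 < σ + σ₀ := fun σ hσ => by linarith [hσ.1]
  have hshift : Continuous fun σ : ℝ => σ + σ₀ := by fun_prop
  have hmaps : MapsTo (fun σ : ℝ => σ + σ₀) (Icc 0 (ν * τ)) (Ioi 0) := fun σ hσ => hage σ hσ
  have hDφ : ∀ σ : ℝ, ∀ y : E,
      fderiv ℝ (fun y' => -driftKernelBarrier 1 (B / ν) hw (σ + σ₀) y' - δ) y =
        -fderiv ℝ (driftKernelBarrier 1 (B / ν) hw (σ + σ₀)) y := by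
    intro σ y
    rw [fderiv_sub_const, fderiv_fun_neg]
  have hΔφ : ∀ σ ∈ Icc 0 (ν * τ), ∀ y : E,
      (Δ fun y' => -driftKernelBarrier 1 (B / ν) hw (σ + σ₀) y' - δ) y =
        -(Δ (driftKernelBarrier 1 (B / ν) hw (σ + σ₀))) y := by
    intro σ hσ y
    have h2 : ContDiffAt ℝ 2 (-driftKernelBarrier 1 (B / ν) hw (σ + σ₀)) y :=
      (contDiff_driftKernelBarrier hwc hws (hage σ hσ)).contDiffAt.neg
    have hfun : (fun y' => -driftKernelBarrier 1 (B / ν) hw (σ + σ₀) y' - δ) =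
        -driftKernelBarrier 1 (B / ν) hw (σ + σ₀) - fun _ => δ := by
      funext y'
      simp only [Pi.sub_apply, Pi.neg_apply]
    rw [hfun, h2.laplacian_sub contDiffAt_const, InnerProductSpace.laplacian_const,
      InnerProductSpace.laplacian_neg]
    simp
  have key := hg.paraboloid_comparison (c := x₀) (t_b := 0) (t_T := ν * τ)
    (P := fun _ => ρ ^ 2)
    (φ := fun σ y => -driftKernelBarrier 1 (B / ν) hw (σ + σ₀) y - δ)
    (φt := fun σ y => -driftKernelBarrierDt 1 (B / ν) hw (σ + σ₀) y)
    isOpen_univ Subset.rfl continuous_const (fun _ _ _ _ => mem_univ _)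
    ?_ ?_ ?_ ?_ ?_ ?_ ?_ ?_ ?_
  · -- conclusion at `σ = ντ`, at the point `x`
    have hx2 : ‖x - x₀‖ ^ 2 ≤ ρ ^ 2 := pow_le_pow_left₀ (norm_nonneg _) hρx 2
    have h1 := key (ν * τ) ⟨hστ.le, le_rfl⟩ x hx2
    have e1 : t + τ - ν * τ / ν = t := by field_simp; ring
    simp only [e1] at h1
    have hage' : 0 < ν * τ + σ₀ := hage _ ⟨hστ.le, le_rfl⟩
    have hint := upperOfMoments_integrable_mul_driftKernel hA hage' (hG.integrable ht'S) x
    have h2 : driftKernelBarrier 1 (B / ν) hw (ν * τ + σ₀) x ≤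
        ∫ z, G (t + τ) z * driftKernel 1 (B / ν) (ν * τ + σ₀) (x - z) :=
      driftKernelBarrier_le_integral hwc hws hage' x hint fun z =>
        mul_le_mul_of_nonneg_right (hwG z) (driftKernel_pos 1 (B / ν) hage' _).le
    linarith
  · -- joint continuity of the barrier
    have h1 : ContinuousOn (fun q : ℝ × E => driftKernelBarrier 1 (B / ν) hw (q.1 + σ₀) q.2)
        (Icc 0 (ν * τ) ×ˢ univ) := by
      refine ContinuousOn.comp (g := fun p : ℝ × E => driftKernelBarrier 1 (B / ν) hw p.1 p.2)
        (f := fun q : ℝ × E => (q.1 + σ₀, q.2))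
        (continuousOn_driftKernelBarrier hwc hws) (by fun_prop) ?_
      rintro ⟨σ, y⟩ ⟨hσ, -⟩
      exact ⟨hage σ hσ, mem_univ _⟩
    exact h1.neg.sub continuousOn_const
  · -- `C²` slices
    intro σ hσ
    exact (contDiff_driftKernelBarrier hwc hws (hage σ hσ)).neg.sub contDiff_const
  · -- time derivative
    intro y σ hσ
    have h1 : HasDerivAt (fun σ' : ℝ => σ' + σ₀) 1 σ := by
      simpa using (hasDerivAt_id σ).add_const σ₀
    have hΨ' := (hasDerivAt_driftKernelBarrier_sigma (ε := 1) (A := B / ν) hwc hws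
      (hage σ hσ) y).comp σ h1
    have h3 := hΨ'.neg.sub_const δ
    simp only [mul_one, Function.comp_def] at h3
    exact h3
  · -- continuity of the time derivative
    intro y
    exact ((continuousOn_driftKernelBarrierDt hwc hws y).comp hshift.continuousOn hmaps).neg
  · -- continuity of the gradient in time
    intro y
    have h1 : ContinuousOn (fun σ => fderiv ℝ (driftKernelBarrier 1 (B / ν) hw (σ + σ₀)) y)
        (Icc 0 (ν * τ)) :=
      (continuousOn_fderiv_driftKernelBarrier hwc hws y).comp hshift.continuousOn hmaps
    exact h1.neg.congr fun σ _ => hDφ σ y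
  · -- continuity of the Laplacian in time
    intro y
    have h1 : ContinuousOn (fun σ => (Δ (driftKernelBarrier 1 (B / ν) hw (σ + σ₀))) y)
        (Icc 0 (ν * τ)) :=
      (continuousOn_laplacian_driftKernelBarrier hwc hws y).comp hshift.continuousOn hmaps
    exact h1.neg.congr fun σ hσ => hΔφ σ hσ y
  · -- the differential inequality `φₜ ≤ Δφ − A ‖∇φ‖` (supersolution `Ψ₊`)
    intro σ hσ y _
    have hσ' : σ ∈ Icc 0 (ν * τ) := ⟨hσ.1.le, hσ.2⟩
    rw [hΔφ σ hσ' y, hDφ σ y, norm_neg]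
    have hBi := driftKernelBarrier_ineq (ε := 1) hwc hws hw0 (Or.inl rfl) hA (hage σ hσ') y
    linarith
  · -- bottom: `G(t + τ) ≤ Ψ₊(σ₀) + δ` on the ball
    intro y hy
    have hyB : y ∈ closedBall x₀ ρ := mem_closedBall_of_norm_sq_le hρ0.le hy
    simp only [zero_add, zero_div, sub_zero]
    have h1 := hAI σ₀ ⟨hσ₀, hσ₀1⟩ y hyB
    have h2 := upperOfMoments_heatExtension_le_driftKernelBarrier hA hwc hws hw0 hσ₀ y
    rw [hwball y hyB] at h1
    linarith
  · -- side: `v ≤ δ ≤ Ψ₊ + δ` for `‖y − x₀‖ = ρ ≥ ρ₀`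
    intro σ hσ y hy
    have hyρ : ‖y - x₀‖ = ρ := (pow_left_inj₀ (norm_nonneg _) hρ0.le two_ne_zero).1 hy
    have hs : t + τ - σ / ν ∈ Icc t (t + τ) := (lowerOfUpper_clamp hν hσ).2
    have h1 : G (t + τ - σ / ν) y ≤ δ := hρ₀ _ hs y (by rw [hyρ]; exact hρρ₀)
    have h2 : 0 ≤ driftKernelBarrier 1 (B / ν) hw (σ + σ₀) y :=
      driftKernelBarrier_nonneg hw0 (hage σ hσ) y
    show -driftKernelBarrier 1 (B / ν) hw (σ + σ₀) y - δ ≤ -G (t + τ - σ / ν) y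
    linarith

end General

/-! ### The registered sub-goal (dimension three) -/

/-- **Registered sub-goal `stub_upperOfMoments_comparison`** (the `ℝ³` form of
`upperOfMoments_comparison`, the comparison half of STUB `stub_upperOfMoments`): for an adapted
backward kernel `G` of `∂ₜ + b·∇ − νΔ` on `Ico t₀ T`, an interior block `[t, t + τ] ⊆ (t₀, T)`
with `‖b‖ ≤ B` there, and uniform spatial decay of `G` on the block, for every `x` and `δ > 0`
there is `σ₀ ∈ (0, ντ]` with `G(t, x) ≤ ∫ G(t + τ, z) k₊(ντ + σ₀, x − z) dz + δ`. -/
theorem stub_upperOfMoments_comparison :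
    ∀ (ν t₀ T t τ B : ℝ) (b : ℝ → EuclideanSpace ℝ (Fin 3) → EuclideanSpace ℝ (Fin 3)) (x₀ : EuclideanSpace ℝ (Fin 3)) (G : ℝ → EuclideanSpace ℝ (Fin 3) → ℝ), 0 < ν → t₀ < t → 0 < τ → t + τ < T → IsSmoothSpaceTimeOn (Ico t₀ T) b → (∀ s ∈ Icc t (t + τ), ∀ x, ‖b s x‖ ≤ B) → 0 ≤ B → IsAdaptedBackwardKernel ν b (Ico t₀ T) T x₀ G → (∀ δ : ℝ, 0 < δ → ∃ ρ₀ : ℝ, ∀ s ∈ Icc t (t + τ), ∀ y, ρ₀ ≤ ‖y - x₀‖ → G s y ≤ δ) → ∀ (x : EuclideanSpace ℝ (Fin 3)) (δ : ℝ), 0 < δ → ∃ σ₀ : ℝ, 0 < σ₀ ∧ σ₀ ≤ ν * τ ∧ G t x ≤ (∫ z, G (t + τ) z * driftKernel 1 (B / ν) (ν * τ + σ₀) (x - z)) + δ :=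
  fun _ _ _ _ _ _ _ _ _ hν ht hτ htT hb hB hB0 hG hdecay x _ hδ =>
    upperOfMoments_comparison hν ht hτ htT hb hB hB0 hG hdecay x hδ

end Summit.NavierStokesRegularity.NavierStokesRegularity.Theorems.AdaptedKernelExists.NashEntropyLastBlock

end
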